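import Summits.BirchSwinnertonDyer.Rank1Residual.Supersingular.MazurTateHeckeDescent
import Summits.BirchSwinnertonDyer.Rank1Residual.Supersingular.SignedOrderOfVanishing
import HarnessLib

/-!
# Hecke descent of the Mazur–Tate elements, part 2: the trivial character (`[0]⁺_f = 0 ⇒ θ_n(0) = 0`
# for all `n`; at `a_3 = +3` also `θ_n(0) = 0` for `n ≡ 2 (mod 6)` UNCONDITIONALLY) and the `a_p = 0`
# trivial zeros as forced layers
# (cell `b2b-bsdres`, supersingular family, prover B = unit `b2b-bsdres-additive-p3`, gen 9; part 2)

HONEST FRAMING (run/shared/lean/b2b/bsd-rank1-residual/, verbatim in every file): the goal of the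
cell is to DELETE the COMBINATION-SHAPED residual classes of the Birch–Swinnerton-Dyer formula for
ALL analytic-rank `≤ 1` elliptic curves over `ℚ` — "full BSD formula for every rank `≤ 1` curve in
class `C`" assembled STRICTLY from published theorems — so that the rank-`≤ 1` remainder becomes
exactly the CONSTRUCTION-SHAPED classes, which are TYPED (missing-input `Prop`s), NOT attempted.
This is not "finishing BSD". THEOREMS ONLY (no definition, no named fact, no `sorry`); nothing about
any particular curve is asserted; nothing is booked; X8 / X7 / X6 stay CONSTRUCTION-SHAPED.

## What this file proves (parts 1a/1b: `MazurTateHeckeDescentSeq.lean`, `MazurTateHeckeDescent.lean`)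

* §5 **Layer zero.** `θ_0(0) = (a_p − 2)[0]⁺_f`, `θ_1(0) = (a_p² − 2a_p − p + 1)[0]⁺_f` (tree, gen 3;
  `p` odd, `p ∤ N`) and the evaluated three-term relation at `ζ = 1` (`θ_{m+2}(0) = a_p θ_{m+1}(0) −
  p θ_m(0)`) give: **`[0]⁺_f = 0` (i.e. `L(E,1) = 0`) ⇒ `θ_n(0) = 0` for EVERY `n`**, hence
  **`T ∣ Θ`** for every integral model `Θ` of any `θ_n` (`X_dvd_mazurTate_of_entireLFunction_one_eq_zero`,
  `…_of_analyticRank_ne_zero`): the `r = 1` of the mixed-layer accounting at analytic rank `≥ 1`, for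
  Mazur–Tate elements at ANY odd good prime (gen 7 had it for `L_p`, `L_p^ε`, `L^•` only).
  **X8 bonus** (`eval₂_mazurTateElement_zero_eq_zero_of_three_of_mod_six`): at `p = 3`, `a_3 = +3` the
  values `θ_n(0)` satisfy `θ_{m+2}(0) = 3θ_{m+1}(0) − 3θ_m(0)` with `θ_0(0) = θ_1(0) = [0]⁺_f`, so
  **`θ_n(0) = 0` for every `n ≡ 2 (mod 6)` WHATEVER `L(E,1)` is** (`θ_2(0) = 0`, `θ_{m+6}(0) = −27θ_m(0)`)
  — a forced zero at the TRIVIAL character (the cell's engine B shows it: `theta_at_0 = 0` at its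
  `N = 3` for every `a_3 = 3` pair, e.g. 12155f1: `3, 3, 0, −9, −27, −54`). No such zero at `a_3 = −3`
  (`θ_0(0) = −5[0]⁺`, `θ_1(0) = 13[0]⁺`, residues `−5, 13, −24, 33, −27, −18` mod the period).
* §6 **`a_p = 0`.** The forced layers of `θ_n` are those at odd distance (`c_{2i+1} = 0`): the mixed
  accounting holds with "`n − (k+1)` odd" as the forced clause
  (`add_sum_totient_le_lam_of_mazurTate_layers_of_frobeniusTrace_eq_zero`) — the classical trivial
  zeros `ω_n^∓ ∣ θ_n` (Kurihara, Pollack Prop. 6.18), recovered from the Hecke descent; so ONE `θ_n`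
  already carries the colourwise count of p222506 up to its level.

References: [MazurTateTeitelbaum1986Invent] §I.4 (4.2), §I.8 (8.6), §I.10 (10.2); [Sprung2017]
Cor. 4.4, Cor. 4.11; [Pollack2003] Prop. 6.18; [Washington1997] §7.1–7.2.
Memo: `HOME/b2b-bsdres-additive-p3/X8-ROUTE-B.md` §14 (gen 9).
-/

set_option autoImplicit false

noncomputable section

open scoped Classical MatrixGroups ModularForm

open CongruenceSubgroup Polynomial WeierstrassCurve Literature.NumberTheory.EllipticCurves
  Literature.NumberTheory.EllipticCurves.ModularForms
  Literature.NumberTheory.EllipticCurves.Sprung2017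
  Literature.NumberTheory.EllipticCurves.Rank1Residual
  Summit.BirchSwinnertonDyer.Rank1Residual.X1.MuLambda
  Summit.BirchSwinnertonDyer.Rank1Residual.Iwasawa

namespace Summit.BirchSwinnertonDyer.Rank1Residual.Supersingular

/-! ## §5. Layer zero: `[0]⁺_f = 0 ⇒ θ_n(0) = 0` for every `n`, so `T ∣ Θ_n` -/

section LayerZero

variable {W : WeierstrassCurve ℚ} [W.IsElliptic] [W.IsGloballyMinimal] {N : ℕ} [NeZero N]
  {f : CuspForm (Gamma0 N) 2} {p : ℕ} [hp : Fact p.Prime]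

omit hp in
/-- `P(0)` through `ℂ_p`: `eval₂ (algebraMap ℚ ℂ_p) 0 P = algebraMap (P.eval 0)`. [folklore] -/
theorem eval₂_algebraMap_zero_eq [Fact p.Prime] (P : ℚ[X]) :
    P.eval₂ (algebraMap ℚ ℂ_[p]) 0 = algebraMap ℚ ℂ_[p] (P.eval 0) := by
  rw [eval₂_at_zero, coeff_zero_eq_eval_zero]

/-- **`θ_0(0) = (a_p − 2)·[0]⁺_f`** (`p` odd, `p ∤ N`; tree `sum_units_ratPlusSymbol_level_one_eq`).
[cite: MazurTateTeitelbaum1986Invent, §I.4 (4.2) and §I.8 (8.6)] -/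
theorem eval₂_mazurTateElement_zero_at_zero (hp2 : p ≠ 2) (hf0 : IsNewform0 f)
    (hQ : coeffField f = ⊥) (hpN : ¬ p ∣ N) {ap : ℤ} (hap : cuspCoeff f p = ap) :
    (mazurTateElement f p 0).eval₂ (algebraMap ℚ ℂ_[p]) 0 =
      algebraMap ℚ ℂ_[p] (((ap : ℚ) - 2) * ratPlusSymbol f 0) := by
  rw [eval₂_algebraMap_zero_eq, mazurTateElement_eval_zero,
    sum_units_ratPlusSymbol_level_one_eq hf0 hQ hpN hap _ (zero_add_cyclotomicExponent_eq hp2)]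

/-- **`θ_1(0) = (a_p² − 2a_p − p + 1)·[0]⁺_f`** (tree `sum_units_ratPlusSymbol_level_two_eq`).
[cite: MazurTateTeitelbaum1986Invent, §I.4 (4.2) and §I.8 (8.6)] -/
theorem eval₂_mazurTateElement_one_at_zero (hp2 : p ≠ 2) (hf0 : IsNewform0 f)
    (hQ : coeffField f = ⊥) (hpN : ¬ p ∣ N) {ap : ℤ} (hap : cuspCoeff f p = ap) :
    (mazurTateElement f p 1).eval₂ (algebraMap ℚ ℂ_[p]) 0 =
      algebraMap ℚ ℂ_[p] ((((ap : ℚ)) ^ 2 - 2 * ap - p + 1) * ratPlusSymbol f 0) := by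
  rw [eval₂_algebraMap_zero_eq, mazurTateElement_eval_zero,
    sum_units_ratPlusSymbol_level_two_eq hf0 hQ hpN hap _ (one_add_cyclotomicExponent_eq hp2)]

/-- **`[0]⁺_f = 0 ⇒ θ_n(0) = 0` for every `n`** (`p` odd good): the values `θ_n(0)` satisfy the
recursion `θ_{m+2}(0) = a_p θ_{m+1}(0) − p θ_m(0)` (evaluated three-term relation at `ζ = 1`,
`Φ_{p^{m+1}}(1) = p`) with `θ_0(0)`, `θ_1(0)` multiples of `[0]⁺_f = L(f,1)/Ω⁺_f`.
[cite: MazurTateTeitelbaum1986Invent, §I.8 (8.6) and §I.10 Prop. (10.2)] -/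
theorem eval₂_mazurTateElement_zero_eq_zero_of_ratPlusSymbol_zero (hp2 : p ≠ 2)
    (hf0 : IsNewform0 f) (hQ : coeffField f = ⊥) (hpN : ¬ p ∣ N) {ap : ℤ}
    (hap : cuspCoeff f p = ap) (h0 : ratPlusSymbol f 0 = 0) (n : ℕ) :
    (mazurTateElement f p n).eval₂ (algebraMap ℚ ℂ_[p]) 0 = 0 := by
  set t : ℕ → ℂ_[p] := fun m ↦ (mazurTateElement f p m).eval₂ (algebraMap ℚ ℂ_[p]) 0 with ht
  have hstep : ∀ m, t (m + 2) = (ap : ℂ_[p]) * t (m + 1) - (p : ℂ_[p]) * t m := by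
    intro m
    have h := eval₂_mazurTateElement_threeTerm hf0 hQ hpN hap m (ζ := 1) (one_pow _)
    rw [eval_cyclotomic_prime_pow_succ_of_pow_eq_one (one_pow _), sub_self] at h
    exact h
  have key : ∀ m, t m = 0 ∧ t (m + 1) = 0 := by
    intro m
    induction m with
    | zero =>
      refine ⟨?_, ?_⟩
      · show (mazurTateElement f p 0).eval₂ (algebraMap ℚ ℂ_[p]) 0 = 0
        rw [eval₂_mazurTateElement_zero_at_zero hp2 hf0 hQ hpN hap, h0, mul_zero, map_zero]
      · show (mazurTateElement f p 1).eval₂ (algebraMap ℚ ℂ_[p]) 0 = 0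
        rw [eval₂_mazurTateElement_one_at_zero hp2 hf0 hQ hpN hap, h0, mul_zero, map_zero]
    | succ m ih =>
      refine ⟨ih.2, ?_⟩
      rw [hstep m, ih.1, ih.2, mul_zero, mul_zero, sub_zero]
  exact (key n).1

omit [NeZero N] in
/-- An integral model `Θ` of `θ_n` with `θ_n(0) = 0` (read in `ℂ_p`) is divisible by `T`. [folklore] -/
theorem X_dvd_mazurTate_of_eval₂_zero_eq_zero {n : ℕ} {Θ : IwasawaAlgebra p}
    (hΘ : iwasawaToPowerSeries p Θ =
      ((mazurTateElement f p n).map (algebraMap ℚ ℚ_[p]) : PowerSeries ℚ_[p]))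
    (h0 : (mazurTateElement f p n).eval₂ (algebraMap ℚ ℂ_[p]) 0 = 0) :
    (PowerSeries.X : IwasawaAlgebra p) ∣ Θ := by
  rw [PowerSeries.X_dvd_iff]
  rw [eval₂_at_zero, map_eq_zero_iff _ (algebraMap ℚ ℂ_[p]).injective] at h0
  have h1 := congr_arg (PowerSeries.coeff 0) hΘ
  rw [iwasawaToPowerSeries, PowerSeries.coeff_map, Polynomial.coeff_coe, Polynomial.coeff_map, h0,
    map_zero, PowerSeries.coeff_zero_eq_constantCoeff_apply,
    map_eq_zero_iff _ (IsFractionRing.injective ℤ_[p] ℚ_[p])] at h1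
  exact h1

/-- **`L(E, 1) = 0 ⇒ T ∣ Θ_n`** for every integral model `Θ_n` of every Mazur–Tate element of the
newform `f` of `E = W` at an odd prime `p` of good reduction (`[0]⁺_f = L(E,1)/Ω⁺_f = 0`,
`ratPlusSymbol_zero_eq_zero_of_entireLFunction_eq_zero`, and §5). The `r = 1` of the mixed-layer
accounting at analytic rank `≥ 1`. [cite: MazurTateTeitelbaum1986Invent, §I.8 (8.6) and §I.10 Prop. (10.2)] -/
theorem X_dvd_mazurTate_of_entireLFunction_one_eq_zero (hp2 : p ≠ 2) (hf : IsNewformOf W f)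
    (hgood : W.HasGoodReductionAtPrime p) (hL1 : W.entireLFunction 1 = 0) {n : ℕ}
    {Θ : IwasawaAlgebra p}
    (hΘ : iwasawaToPowerSeries p Θ =
      ((mazurTateElement f p n).map (algebraMap ℚ ℚ_[p]) : PowerSeries ℚ_[p])) :
    (PowerSeries.X : IwasawaAlgebra p) ∣ Θ :=
  X_dvd_mazurTate_of_eval₂_zero_eq_zero hΘ
    (eval₂_mazurTateElement_zero_eq_zero_of_ratPlusSymbol_zero hp2 hf.1 hf.coeffField_eq_bot
      (not_dvd_level_of_isNewformOf hf hgood) (cuspCoeff_eq_frobeniusTrace_of_isNewformOf_holds hf hgood)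
      (ratPlusSymbol_zero_eq_zero_of_entireLFunction_eq_zero hf hL1) n)

/-- **`ord_{s=1} L(E, s) ≠ 0 ⇒ T ∣ Θ_n`** (positive analytic rank). [cite: MazurTateTeitelbaum1986Invent, §I.8 (8.6) and §I.10 Prop. (10.2)] -/
theorem X_dvd_mazurTate_of_analyticRank_ne_zero (hp2 : p ≠ 2) (hf : IsNewformOf W f)
    (hgood : W.HasGoodReductionAtPrime p) (hr : W.analyticRank ≠ 0) {n : ℕ} {Θ : IwasawaAlgebra p}
    (hΘ : iwasawaToPowerSeries p Θ =
      ((mazurTateElement f p n).map (algebraMap ℚ ℚ_[p]) : PowerSeries ℚ_[p])) :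
    (PowerSeries.X : IwasawaAlgebra p) ∣ Θ :=
  X_dvd_mazurTate_of_entireLFunction_one_eq_zero hp2 hf hgood
    (entireLFunction_one_eq_zero_of_analyticRank_ne_zero' hr) hΘ


/-- **X8 (`a_3 = +3`): a FORCED zero at the trivial character.** For a rational newform `f` with
`3 ∤ N` and `a_3(f) = 3`: `θ_n(0) = 0` for every `n ≡ 2 (mod 6)`, WHATEVER `[0]⁺_f = L(f,1)/Ω⁺_f` is.
Indeed `θ_0(0) = (a_3 − 2)[0]⁺ = [0]⁺`, `θ_1(0) = (a_3² − 2a_3 − 3 + 1)[0]⁺ = [0]⁺`, and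
`θ_{m+2}(0) = 3θ_{m+1}(0) − 3θ_m(0)`, so `θ_2(0) = 0` and `θ_{m+6}(0) = −27·θ_m(0)`.
[cite: MazurTateTeitelbaum1986Invent, §I.4 (4.2) and §I.10 Prop. (10.2)] -/
theorem eval₂_mazurTateElement_zero_eq_zero_of_three_of_mod_six (hp3 : p = 3) (hf0 : IsNewform0 f)
    (hQ : coeffField f = ⊥) (hpN : ¬ p ∣ N) (hap : cuspCoeff f p = ((3 : ℤ) : ℂ)) {n : ℕ}
    (hn : n % 6 = 2) : (mazurTateElement f p n).eval₂ (algebraMap ℚ ℂ_[p]) 0 = 0 := by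
  subst hp3
  have hp2 : (3 : ℕ) ≠ 2 := by decide
  set t : ℕ → ℂ_[3] := fun m ↦ (mazurTateElement f 3 m).eval₂ (algebraMap ℚ ℂ_[3]) 0 with ht
  have hstep : ∀ m, t (m + 2) = 3 * t (m + 1) - 3 * t m := by
    intro m
    have h := eval₂_mazurTateElement_threeTerm hf0 hQ hpN hap m (ζ := 1) (one_pow _)
    rw [eval_cyclotomic_prime_pow_succ_of_pow_eq_one (one_pow _), sub_self] at h
    push_cast at h
    exact h
  have h0 : t 0 = algebraMap ℚ ℂ_[3] (ratPlusSymbol f 0) := by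
    show (mazurTateElement f 3 0).eval₂ (algebraMap ℚ ℂ_[3]) 0 = _
    rw [eval₂_mazurTateElement_zero_at_zero hp2 hf0 hQ hpN hap]
    norm_num
  have h1 : t 1 = algebraMap ℚ ℂ_[3] (ratPlusSymbol f 0) := by
    show (mazurTateElement f 3 1).eval₂ (algebraMap ℚ ℂ_[3]) 0 = _
    rw [eval₂_mazurTateElement_one_at_zero hp2 hf0 hQ hpN hap]
    norm_num
  have h2 : t 2 = 0 := by rw [hstep 0, zero_add, h1, h0]; ring
  have hper : ∀ m, t (m + 6) = -27 * t m := by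
    intro m
    have e2 := hstep m
    have e3 : t (m + 3) = 3 * t (m + 2) - 3 * t (m + 1) := by
      rw [show m + 3 = (m + 1) + 2 by ring, hstep, show m + 1 + 1 = m + 2 by ring]
    have e4 : t (m + 4) = 3 * t (m + 3) - 3 * t (m + 2) := by
      rw [show m + 4 = (m + 2) + 2 by ring, hstep, show m + 2 + 1 = m + 3 by ring]
    have e5 : t (m + 5) = 3 * t (m + 4) - 3 * t (m + 3) := by
      rw [show m + 5 = (m + 3) + 2 by ring, hstep, show m + 3 + 1 = m + 4 by ring]
    have e6 : t (m + 6) = 3 * t (m + 5) - 3 * t (m + 4) := by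
      rw [show m + 6 = (m + 4) + 2 by ring, hstep, show m + 4 + 1 = m + 5 by ring]
    rw [e6, e5, e4, e3, e2]
    ring
  have key : ∀ q, t (6 * q + 2) = 0 := by
    intro q
    induction q with
    | zero => simpa using h2
    | succ q ih => rw [show 6 * (q + 1) + 2 = (6 * q + 2) + 6 by ring, hper, ih, mul_zero]
  have hn' : n = 6 * (n / 6) + 2 := by omega
  rw [hn']
  exact key (n / 6)

end LayerZero

/-! ## §6. `a_p = 0`: the layers at odd distance are forced (trivial zeros) -/

section APZero

variable {W : WeierstrassCurve ℚ} [W.IsElliptic] [W.IsGloballyMinimal] {N : ℕ} [NeZero N]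
  {f : CuspForm (Gamma0 N) 2} {p : ℕ} [hp : Fact p.Prime]

/-- **Mixed-layer accounting at `a_p = 0`** (X6/X7, and every supersingular `p ≥ 5`): `f` the
newform of `E = W`, `p` good with `a_p(E) = 0`, `Θ ≠ 0` an integral model of `θ_n`, `T^r ∣ Θ`, `S` a
finite set of layers `k + 1 ≤ n` each either at ODD distance `n − (k+1)` (forced: `c_{2i+1} = 0`, the
classical trivial zeros `ω_n^∓ ∣ θ_n`) or VANISHING (a primitive even `p`-power-order `χ` of conductor
`p^{k+1+e₀}` with `∑ χ(a)[a/p^{k+1+e₀}]⁺_f = 0`). Then `r + Σ_{k ∈ S} φ(p^{k+1}) ≤ λ(Θ)`.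
[cite: Pollack2003, Prop. 6.18] [cite: MazurTateTeitelbaum1986Invent, §I.10 Prop. (10.2)] -/
theorem add_sum_totient_le_lam_of_mazurTate_layers_of_frobeniusTrace_eq_zero (hf : IsNewformOf W f)
    (hgood : W.HasGoodReductionAtPrime p) (hap0 : W.frobeniusTrace p = 0) {n : ℕ}
    {Θ : IwasawaAlgebra p}
    (hΘ : iwasawaToPowerSeries p Θ =
      ((mazurTateElement f p n).map (algebraMap ℚ ℚ_[p]) : PowerSeries ℚ_[p]))
    (hΘ0 : Θ ≠ 0) {r : ℕ} (hX : (PowerSeries.X : IwasawaAlgebra p) ^ r ∣ Θ) (S : Finset ℕ)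
    (hS : ∀ k ∈ S, k + 1 ≤ n ∧ (Odd (n - (k + 1)) ∨
      ∃ χ : DirichletCharacter ℂ_[p] (p ^ (k + 1 + cyclotomicExponent p)), χ.IsPrimitive ∧ χ.Even ∧
        (∃ j : ℕ, orderOf χ = p ^ j) ∧ ratTwistedSymbolSum f χ = 0)) :
    r + ∑ k ∈ S, Nat.totient (p ^ (k + 1)) ≤ lam Θ := by
  obtain ⟨c, hc0, hc1, hrec⟩ := exists_heckeDescentSeq 0 p
  have hap : cuspCoeff f p = ((0 : ℤ) : ℂ) := by
    rw [cuspCoeff_eq_frobeniusTrace_of_isNewformOf_holds hf hgood, hap0]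
  refine add_sum_totient_le_lam_of_mazurTate_layers hf.1 hf.coeffField_eq_bot
    (not_dvd_level_of_isNewformOf hf hgood) hap hΘ hΘ0 hX hc0 hc1 hrec S fun k hk ↦ ?_
  obtain ⟨hkn, hodd | hvan⟩ := hS k hk
  · exact ⟨hkn, Or.inl ((heckeDescentSeq_eq_zero_iff_odd_of_ap_eq_zero hp.out.ne_zero hc0 hc1 hrec
      _).mpr hodd)⟩
  · exact ⟨hkn, Or.inr hvan⟩

end APZero

end Summit.BirchSwinnertonDyer.Rank1Residual.Supersingular

end
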